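import Summits.BirchSwinnertonDyer.BirchSwinnertonDyer.Theorems.PrintCf2SplitBadEisensteinTwoDivisibilitiesHalfDescentCore
import Summits.BirchSwinnertonDyer.Rank1Residual.Partition.CornersCM
import Literature.NumberTheory.EllipticCurves.HeegnerPointsKolyvaginExceptionalTwistProofs
import HarnessLib

/-!
# Crux `PrintCf2.SplitBadTwoRankOneOfFacts` (item 20368) and its halves 27850 / 27851 — each half of `BSD₂` over `ℚ` for a CM curve of
# analytic rank one from the SAME half over ANY quadratic field whose twist partner has analytic rank zero (road ε: `F = ℚ(√ε)`)

Cell `bsd-print-cf2`, seat `bsd-line-cf2-p1` g8 (LEAD on crux stmt-BirchSwinnertonDyer-20368). `--supports stmt-BirchSwinnertonDyer-20368`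
(helper). THEOREMS ONLY (0 definitions, 0 named facts, 0 `sorry`); CONDITIONAL on every displayed hypothesis. BSD is proved for no curve
by any of this; no summit statement is proved by this seat.

WHY (memo `Cruxes/SplitBadTwoRankOneOfFacts/LEAD-VERDICT-cf2p1-g8.md` §3, road ε). The skeletons of record transport a `K`-side half of
`BSD₂` to `ℚ` along a HEEGNER field `K` chosen by Friedberg–Hoffstein (lead g7 p631598 §1 + -w4 g2 p636912 / lead g8 p638495). But the
one-sided Milne descent `missing{Upper,Lower}BoundAt_of_{upper,lower}Over_of_bsdp_twist` needs only: `F/ℚ` quadratic, `r_an(W) ≤ 1`,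
`r_an(W^{(d_F)}) ≤ 1` and `BSD₂` of the twist partner. For a CM curve the partner's `BSD₂` in analytic rank ZERO is Burungale–Flach
(`bsdp_cm_rankZero`, conjunct `bsdTriple_of_hasCM_of_L_one_ne_zero` of 𝔅_split). Hence, for a CM curve `W` of analytic rank one and ANY
quadratic field `F` with `L(W^{(d_F)}, 1) ≠ 0`, each half of `BSD₂(W)` follows from the same half for a globally minimal `F`-model of
`W_F` — `F` need NOT be a Heegner field of `N_W`. On the split-bad class (`W = 49a^{(d)}`, `d ≢ 1 (mod 4)`, additive at `2`) this opens
ROAD ε: take `F = ℚ(√ε)`, `ε ∈ {−1, 2, −2}` the twist type of `W` (`W^{(ε)}` GOOD at `2`, w2's `PrintCf2SplitBadTwistTypeFamilies`), so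
that `W_F ≅ (W^{(ε)})_F` is a CM curve with GOOD ORDINARY reduction above `2` over a quadratic field in which `2` ramifies; for the two
EXTERNAL types `ε = −1, −2` the partner `W^{(d_F)} = W^{(ε)}` has root number `+1`, so `L(W^{(ε)},1) ≠ 0` is the generic case, and there
the additive-at-`2` class member is traded for a rank-one GOOD-ORDINARY CM curve over `ℚ(i)` resp. `ℚ(√−2)` (Li–Tian–Yan–Zhu 2025
§1.3 announce exactly the extension of their `2`-adic method to abelian bases `F₀/K` with good ordinary reduction above `2`).

* `missingUpperBoundAt_two_of_upperOver_quadratic_of_cm_partner_rankZero` — Kolyvagin half;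
* `missingLowerBoundAt_two_of_lowerOver_quadratic_of_cm_partner_rankZero` — Eisenstein half;
* `bsdp_two_of_pPartOver_quadratic_of_cm_partner_rankZero` — both halves at once (`MissingPPartOverAt` of the `F`-model ⟹ `BSDp W 2`).

References: [Milne1972ArithmeticAV] §1 Thm. 1; [BurungaleFlach2024] Thm. 1.1, Cor. 2; [Miller2011LMS] Def. 1.1; [LiTianYanZhu2025] §1.3
(II) and the paragraph after it (abelian base `F₀`, good ordinary above `2`).
-/

set_option autoImplicit false

-- D-0017 layout: summit = sub-problem, so `Summit.BirchSwinnertonDyer.BirchSwinnertonDyer.…` is the mandated namespace of Theorems files.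
set_option linter.dupNamespace false

noncomputable section

open scoped Classical NumberField

namespace Summit.BirchSwinnertonDyer.BirchSwinnertonDyer.Theorems.PrintCf2.EisensteinTwo

open WeierstrassCurve NumberField Literature.NumberTheory.EllipticCurves Literature.NumberTheory.EllipticCurves.Rank1Residual
  Literature.NumberTheory.EllipticCurves.Rank1Residual.Typed
  Summit.BirchSwinnertonDyer.Rank1Residual Summit.BirchSwinnertonDyer.Rank1Residual.AdditivePotMult

section Partner

variable (W : WeierstrassCurve ℚ) [W.IsElliptic] [W.IsGloballyMinimal]
  (F : Type) [Field F] [NumberField F] (W' : WeierstrassCurve F) [W'.IsElliptic] [W'.IsGloballyMinimal]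

omit [W.IsGloballyMinimal] in
/-- **The twist partner's `BSD₂` for a CM curve** (Burungale–Flach via `bsdp_cm_rankZero`, + modularity for `L(W^{(d_F)},1) ≠ 0 ⟹
r_an = 0`): every globally minimal model `Wd` of `W^{(d_F)}` has `BSD₂` and analytic rank `0`. `F` is any number field here (only its
discriminant enters). [cite: BurungaleFlach2024, Thm. 1.1 and Cor. 2] -/
theorem bsdp_two_and_analyticRank_partner_of_hasCM (hBF : bsdTriple_of_hasCM_of_L_one_ne_zero) (hmod : hasEntireLFunction_rat)
    (hCM : W.HasCM) (hL : (W.quadraticTwist (NumberField.discr F : ℚ)).entireLFunction 1 ≠ 0)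
    (Wd : WeierstrassCurve ℚ) [Wd.IsElliptic] [Wd.IsGloballyMinimal]
    (hWd : ∃ C : VariableChange ℚ, C • W.quadraticTwist (NumberField.discr F : ℚ) = Wd) :
    BSDp Wd 2 ∧ Wd.analyticRank = 0 := by
  obtain ⟨C, rfl⟩ := hWd
  have hd : (NumberField.discr F : ℚ) ≠ 0 := by exact_mod_cast NumberField.discr_ne_zero F
  haveI hEd : (W.quadraticTwist (NumberField.discr F : ℚ)).IsElliptic := W.isElliptic_quadraticTwist hd
  have hCMd : (W.quadraticTwist (NumberField.discr F : ℚ)).HasCM := hasCM_quadraticTwist_of_hasCM W hCM hd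
  have hCM' : (C • W.quadraticTwist (NumberField.discr F : ℚ)).HasCM :=
    hasCM_variableChange (W.quadraticTwist (NumberField.discr F : ℚ)) C hCMd
  have hr0d : (W.quadraticTwist (NumberField.discr F : ℚ)).analyticRank = 0 :=
    (analyticRank_eq_zero_iff_holds (hmod _)).mpr hL
  have hr0 : (C • W.quadraticTwist (NumberField.discr F : ℚ)).analyticRank = 0 := by
    rw [WeierstrassCurve.analyticRank_smul]; exact hr0d
  exact ⟨bsdp_cm_rankZero hBF hmod hCM' hr0, hr0⟩

/-- **ROAD ε, Kolyvagin half.** `W/ℚ` globally minimal with CM and `r_an(W) ≤ 1`; `F` ANY quadratic field with `L(W^{(d_F)}, 1) ≠ 0`;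
`W'` a globally minimal `F`-model of `W_F`. GIVEN GZK `hGZK`, modularity `hmod`, Milne on minimal models `hMilne`, Burungale–Flach `hBF`:
the `F`-side UPPER half «`#Ш_an(W')` is a rational `q'` with `ord₂ #Ш(W') ≤ ord₂ q'`» gives `MissingUpperBoundAt W 2`
(`ord₂ #Ш(W) ≤ ord₂ #Ш_an(W)`). `F` need not be a Heegner field of `N_W`: on the split-bad class take `F = ℚ(√ε)` with `W^{(ε)}` good at
`2`, so that `W'` is a good-ordinary-above-`2` CM curve. [cite: Milne1972ArithmeticAV, §1 Thm. 1] [cite: BurungaleFlach2024, Cor. 2]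
[cite: Miller2011LMS, Def. 1.1] -/
theorem missingUpperBoundAt_two_of_upperOver_quadratic_of_cm_partner_rankZero
    (hGZK : rank_eq_analyticRank_of_analyticRank_le_one) (hmod : hasEntireLFunction_rat)
    (hMilne : Milne1972.bsdQuotient_baseChange_quadratic) (hBF : bsdTriple_of_hasCM_of_L_one_ne_zero)
    (hCM : W.HasCM) (hr : W.analyticRank ≤ 1) (h2 : Module.finrank ℚ F = 2)
    (hL : (W.quadraticTwist (NumberField.discr F : ℚ)).entireLFunction 1 ≠ 0)
    (hW' : ∃ C : VariableChange F, C • W.baseChange F = W')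
    (hFup : ∃ q' : ℚ, shaAnOver W' = (q' : ℂ) ∧ (padicValNat 2 W'.shaOrder : ℤ) ≤ padicValRat 2 q') :
    MissingUpperBoundAt W 2 := by
  have hd : (NumberField.discr F : ℚ) ≠ 0 := by exact_mod_cast NumberField.discr_ne_zero F
  haveI hEd : (W.quadraticTwist (NumberField.discr F : ℚ)).IsElliptic := W.isElliptic_quadraticTwist hd
  obtain ⟨Cd, hCd⟩ := hasGlobalMinimalModel_rat_holds (W.quadraticTwist (NumberField.discr F : ℚ))
  haveI : (Cd • W.quadraticTwist (NumberField.discr F : ℚ)).IsGloballyMinimal := hCd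
  obtain ⟨hWd, hr0⟩ := bsdp_two_and_analyticRank_partner_of_hasCM W F hBF hmod hCM hL
    (Cd • W.quadraticTwist (NumberField.discr F : ℚ)) ⟨Cd, rfl⟩
  have hrd : (Cd • W.quadraticTwist (NumberField.discr F : ℚ)).analyticRank ≤ 1 := by rw [hr0]; exact zero_le_one
  exact missingUpperBoundAt_of_upperOver_of_bsdp_twist W 2 F (Cd • W.quadraticTwist (NumberField.discr F : ℚ)) W'
    hGZK hmod hMilne hr h2 ⟨Cd, rfl⟩ hrd hW' hFup hWd

/-- **ROAD ε, Eisenstein half.** Same data with the `F`-side LOWER half «`#Ш_an(W') = q'` rational with `ord₂ q' ≤ ord₂ #Ш(W')`»: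
THEN `MissingLowerBoundAt W 2` (`ord₂ #Ш_an(W) ≤ ord₂ #Ш(W)`). [cite: Milne1972ArithmeticAV, §1 Thm. 1] [cite: BurungaleFlach2024, Cor. 2]
[cite: Miller2011LMS, Def. 1.1] -/
theorem missingLowerBoundAt_two_of_lowerOver_quadratic_of_cm_partner_rankZero
    (hGZK : rank_eq_analyticRank_of_analyticRank_le_one) (hmod : hasEntireLFunction_rat)
    (hMilne : Milne1972.bsdQuotient_baseChange_quadratic) (hBF : bsdTriple_of_hasCM_of_L_one_ne_zero)
    (hCM : W.HasCM) (hr : W.analyticRank ≤ 1) (h2 : Module.finrank ℚ F = 2)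
    (hL : (W.quadraticTwist (NumberField.discr F : ℚ)).entireLFunction 1 ≠ 0)
    (hW' : ∃ C : VariableChange F, C • W.baseChange F = W')
    (hFlo : ∃ q' : ℚ, shaAnOver W' = (q' : ℂ) ∧ padicValRat 2 q' ≤ (padicValNat 2 W'.shaOrder : ℤ)) :
    MissingLowerBoundAt W 2 := by
  have hd : (NumberField.discr F : ℚ) ≠ 0 := by exact_mod_cast NumberField.discr_ne_zero F
  haveI hEd : (W.quadraticTwist (NumberField.discr F : ℚ)).IsElliptic := W.isElliptic_quadraticTwist hd
  obtain ⟨Cd, hCd⟩ := hasGlobalMinimalModel_rat_holds (W.quadraticTwist (NumberField.discr F : ℚ))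
  haveI : (Cd • W.quadraticTwist (NumberField.discr F : ℚ)).IsGloballyMinimal := hCd
  obtain ⟨hWd, hr0⟩ := bsdp_two_and_analyticRank_partner_of_hasCM W F hBF hmod hCM hL
    (Cd • W.quadraticTwist (NumberField.discr F : ℚ)) ⟨Cd, rfl⟩
  have hrd : (Cd • W.quadraticTwist (NumberField.discr F : ℚ)).analyticRank ≤ 1 := by rw [hr0]; exact zero_le_one
  exact missingLowerBoundAt_of_lowerOver_of_bsdp_twist W 2 F (Cd • W.quadraticTwist (NumberField.discr F : ℚ)) W'
    hGZK hmod hMilne hr h2 ⟨Cd, rfl⟩ hrd hW' hFlo hWd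

/-- **ROAD ε, both halves.** If the `F`-model `W'` carries the whole `2`-part over `F` (`MissingPPartOverAt W' 2`: `#Ш_an(W') = q'` with
`ord₂ q' = ord₂ #Ш(W')`), then `BSDp W 2` (Miller's `BSD(E,2)`) — via the two halves and `bsdp_of_missingPPartAt` (GZK for finiteness).
[cite: Milne1972ArithmeticAV, §1 Thm. 1] [cite: BurungaleFlach2024, Cor. 2] [cite: Miller2011LMS, Def. 1.1] -/
theorem bsdp_two_of_pPartOver_quadratic_of_cm_partner_rankZero
    (hGZK : rank_eq_analyticRank_of_analyticRank_le_one) (hmod : hasEntireLFunction_rat)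
    (hMilne : Milne1972.bsdQuotient_baseChange_quadratic) (hBF : bsdTriple_of_hasCM_of_L_one_ne_zero)
    (hCM : W.HasCM) (hr : W.analyticRank ≤ 1) (h2 : Module.finrank ℚ F = 2)
    (hL : (W.quadraticTwist (NumberField.discr F : ℚ)).entireLFunction 1 ≠ 0)
    (hW' : ∃ C : VariableChange F, C • W.baseChange F = W') (hF : MissingPPartOverAt W' 2) :
    BSDp W 2 := by
  obtain ⟨q', hq', hv⟩ := hF
  exact bsdp_of_missingPPartAt W 2 hGZK hr
    (missingPPartAt_of_lower_of_upper W 2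
      (missingLowerBoundAt_two_of_lowerOver_quadratic_of_cm_partner_rankZero W F W' hGZK hmod hMilne hBF hCM hr h2 hL hW'
        ⟨q', hq', hv.le⟩)
      (missingUpperBoundAt_two_of_upperOver_quadratic_of_cm_partner_rankZero W F W' hGZK hmod hMilne hBF hCM hr h2 hL hW'
        ⟨q', hq', hv.ge⟩))

end Partner

end Summit.BirchSwinnertonDyer.BirchSwinnertonDyer.Theorems.PrintCf2.EisensteinTwo

end
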